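import Summits.ResolutionOfSingularities.ResolutionOfSingularities.Theorems.FrobeniusClosingPatchingRelPerfectDepthOneTargetsDefs
import Literature.AlgebraicGeometry.Resolution.StrictNormalCrossings
import Literature.AlgebraicGeometry.Resolution.EmbeddedResolutionExcellentSurfacesSequence
import Literature.AlgebraicGeometry.Resolution.MarkedIdeals
import HarnessLib

/-!
# Chain W5.2 — typed TARGETS «F2» (plan-1 gen 6, CRUX-PLAN v3.3 §6j/§7): the WEIGHTED E-SIDE —
# weighted blow-up sequences, order-permissibility, the snc cleanup and the weight-two trace theorem

[OURS · L1 W5.2] Statements (Props) + two sanity lemmas; NOT statements of the manuscript under review.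
Crux `PatchingRelPerfect` (stmt-ResolutionOfSingularities-16161), line `closed_point_slice`, open stub
`stub_atomDimFourBlowup` (CORE). Companion of «F1» (`…Theorems.FrobeniusClosingPatchingRelPerfectDepthTargetsDefs`,
p498219: the depth-`ℓ` X-side dictionary `DepthInvariant ℓ`, `DictionaryStepPow ℓ`, `ExceptionalPackagePow ℓ`).

WHY (CRUX-PLAN v3.3 §7, kernel sentence v1.6). On the X-side the residual ideal `K` of a depth-`ℓ` ideal has the
exceptional divisor `E` as a regular hypersurface of LITERAL maximal contact (`𝓘_E^ℓ ≤ K`), and a blowing up along a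
regular centre `Z ⊆ E` is matched by the dictionary (D_ℓ) as long as it is PERMISSIBLE WITH SOME WEIGHT
`1 ≤ ν ≤ ℓ` (`K ≤ 𝓘_Z^ν`); the E-side process driving it is a sequence of blowings up of the regular threefold
`E` along regular centres, each with its own weight `ν_j ≤ ℓ`, the E-side ideal transforming by the weight-`ν_j`
controlled transform (`IsWeightedSeq ℓ`; all weights `= ℓ`: `IsPureWeightedSeq ℓ`, the regime in which literal
maximal contact is preserved — F1 `DictionaryStepPow`; weights `< ℓ` degrade it to MONOMIAL contact
`N · 𝓘_{E'}^ℓ ≤ K'`, `N` an exceptional monomial, whose escaped cosupport consists of problems of SMALLER depth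
`ℓ - ν` on the new exceptional carriers — §7 (R4 design): induction on the depth). This file fixes the E-side
vocabulary and the three E-side statements every variant of rung R4 (`ℓ = 2`) consumes:

* `OrderPermissible` — permissibility is a condition on the ORDER LOCUS: a regular centre inside
  `{x | ν ≤ ord_x 𝔟}` satisfies `𝔟 ≤ 𝓘_Z^ν` (ordinary = symbolic powers for regular centres on a regular scheme);
  this is the bridge from the literature's support condition (BGMW Def. 3.1.3 (1), the tree's
  `CentreSeq.IsAdmissibleFor`) to the ideal-theoretic hypothesis of D1/D_ℓ;
* `WeightedCleanupSNC μ` — FACT-FREE: a non-zero locally principal ideal with strict-normal-crossings support on a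
  regular scheme is brought below order `μ` by a PURE weight-`μ` sequence along strata (the tree's monomial case
  `exists_isResolutionOf_monomialMarked`, Kollár (3.111) Step 3, translated; any dimension);
* `WeightTwoPrincipal₃` — the WEIGHT-TWO TRACE THEOREM on regular excellent threefolds: a non-zero locally principal
  ideal is brought to order `≤ 1` everywhere by a weighted sequence with weights `≤ 2`, from CJS 2020 Thm. 1.4 with
  boundary (F-32bR `CossartJannsenSaito2020EmbeddedSequenceB`: centres singular points of the strict transform —
  weight 2 — or regular points on the boundary — weight `min(2, ord)`; end state snc) followed by
  `WeightedCleanupSNC 2`. This is the E-side of the SINGLETON depth-two rung R4ˢ (members `(F) + 𝔪^{e+2}`,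
  `F ≡ F_e (mod 𝔪^{e+2})`; tri-1 TRIAGE r3 04:37:02Z «type the singleton case first»).

## Contents
* §1 `IsWeightedSeq μ`, `IsPureWeightedSeq μ` (+ `IsPureWeightedSeq.isWeightedSeq`, `IsWeightedSeq.mono` PROVED);
* §2 `OrderPermissible` — TARGET (fact-free, M);
* §3 `WeightedCleanupSNC μ` — TARGET (fact-free, M/L; the monomial case translated);
* §4 `WeightTwoPrincipal₃` — TARGET (L; consumes F-32bR as a hypothesis INSIDE the statement, like A2s).

## References (pointers in prose; bib keys of `docs/references.bib`)
* E. Bierstone, D. Grigoriev, P. Milman, J. Włodarczyk, *Effective Hironaka resolution and its complexity*, Asian J.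
  Math. 15 (2011) = arXiv:1206.3090, §3.1 Def. 3.1.3, §3.2 (controlled transform), §4 Step 2b (monomial case).
  [BierstoneGrigorievMilmanWlodarczyk2011]
* J. Kollár, *Lectures on Resolution of Singularities* (2007), (3.111) Step 3; 3.30.2. [Kollar2007]
* V. Cossart, U. Jannsen, S. Saito, *Desingularization: invariants and strategy*, LNM 2270 (2020), Thm. 1.4,
  Cor. 1.5, Def. 3.1. [CossartJannsenSaito2020]
* U. Görtz, T. Wedhorn, *Algebraic Geometry I*, 2nd ed. (2020), Prop. 13.91 (1), 13.96 (2). [GortzWedhorn2020]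
* H. Matsumura, *Commutative Ring Theory* (1986), Thm. 14.4, 16.2 (regular sequences; `P^{(n)} = P^n` for primes
  generated by a subset of a regular system of parameters via `gr_P` a polynomial ring over a domain). [Matsumura1987]
-/

-- `Summit.<Summit>.<Sub>.Theorems` with `Sub = Summit` (single-conjunct summit, D-0017)
set_option linter.dupNamespace false

noncomputable section

open CategoryTheory CategoryTheory.Limits AlgebraicGeometry TopologicalSpace
open Literature.AlgebraicGeometry.Resolution

namespace Summit.ResolutionOfSingularities.ResolutionOfSingularities.Theorems.DepthTargets

universe u

/-! ## §1 Weighted blow-up sequences on the E-side -/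

/-- [OURS · L1 W5.2] **Weighted controlled blow-up sequences** (BGMW Def. 3.1.3 / Kollár 3.30.2, data-free as
`DepthOneTargets.IsControlledSeq`): `ρ : E' → E` is a finite composite of blowings up along centres `C_j` with
`V(C_j)` regular, the `j`-th one PERMISSIBLE WITH WEIGHT `ν_j`, `1 ≤ ν_j ≤ μ` — `𝔟_j ≤ C_j ^ ν_j` — and
`𝔟_{j+1}` the weight-`ν_j` controlled transform of `𝔟_j`: `𝔟_j𝒪 = (C_j𝒪)^{ν_j} · 𝔟_{j+1}`. For `μ = 1` this is
`IsControlledSeq` up to `pow_one`. [cite: BierstoneGrigorievMilmanWlodarczyk2011, Def. 3.1.3, §3.2]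
[cite: Kollar2007, 3.30.2] -/
inductive IsWeightedSeq (μ : ℕ) :
    ∀ {E' E : Scheme.{u}}, (E' ⟶ E) → E.IdealSheafData → E'.IdealSheafData → Prop
  /-- the empty sequence -/
  | nil {E : Scheme.{u}} (𝔟 : E.IdealSheafData) : IsWeightedSeq μ (𝟙 E) 𝔟 𝔟
  /-- one more blowing up along a regular centre, permissible with weight `ν ≤ μ` -/
  | cons {E'' E' E : Scheme.{u}} (τ : E'' ⟶ E') (ρ : E' ⟶ E) (𝔟 : E.IdealSheafData)
      (𝔟' : E'.IdealSheafData) (𝔟'' : E''.IdealSheafData) (C : E'.IdealSheafData) (ν : ℕ) :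
      IsWeightedSeq μ ρ 𝔟 𝔟' →
      Scheme.IsRegular C.subscheme →
      1 ≤ ν → ν ≤ μ →
      𝔟' ≤ C ^ ν →
      IsBlowup τ C →
      𝔟'.comap τ = C.comap τ ^ ν * 𝔟'' →
      IsWeightedSeq μ (τ ≫ ρ) 𝔟 𝔟''

/-- [OURS · L1 W5.2] **Pure weight-`μ` sequences**: every step has weight exactly `μ` (the regime in which the
X-side keeps LITERAL maximal contact, F1 `DictionaryStepPow`). [cite: BierstoneGrigorievMilmanWlodarczyk2011, Def. 3.1.3, §3.2] -/
inductive IsPureWeightedSeq (μ : ℕ) :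
    ∀ {E' E : Scheme.{u}}, (E' ⟶ E) → E.IdealSheafData → E'.IdealSheafData → Prop
  /-- the empty sequence -/
  | nil {E : Scheme.{u}} (𝔟 : E.IdealSheafData) : IsPureWeightedSeq μ (𝟙 E) 𝔟 𝔟
  /-- one more blowing up along a regular centre, permissible with weight `μ` -/
  | cons {E'' E' E : Scheme.{u}} (τ : E'' ⟶ E') (ρ : E' ⟶ E) (𝔟 : E.IdealSheafData)
      (𝔟' : E'.IdealSheafData) (𝔟'' : E''.IdealSheafData) (C : E'.IdealSheafData) :
      IsPureWeightedSeq μ ρ 𝔟 𝔟' →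
      Scheme.IsRegular C.subscheme →
      𝔟' ≤ C ^ μ →
      IsBlowup τ C →
      𝔟'.comap τ = C.comap τ ^ μ * 𝔟'' →
      IsPureWeightedSeq μ (τ ≫ ρ) 𝔟 𝔟''

/-- A pure weight-`μ` sequence (`1 ≤ μ`) is a weighted sequence with weights `≤ μ`. [folklore] -/
theorem IsPureWeightedSeq.isWeightedSeq {μ : ℕ} (hμ : 1 ≤ μ) :
    ∀ {E' E : Scheme.{u}} {ρ : E' ⟶ E} {𝔟 : E.IdealSheafData} {𝔟' : E'.IdealSheafData},
      IsPureWeightedSeq μ ρ 𝔟 𝔟' → IsWeightedSeq μ ρ 𝔟 𝔟'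
  | _, _, _, _, _, .nil 𝔟 => .nil 𝔟
  | _, _, _, _, _, .cons τ ρ 𝔟 𝔟' 𝔟'' C h hC hle hτ heq =>
    .cons τ ρ 𝔟 𝔟' 𝔟'' C μ (h.isWeightedSeq hμ) hC hμ le_rfl hle hτ heq

/-- Weighted sequences are monotone in the weight bound. [folklore] -/
theorem IsWeightedSeq.mono {μ μ' : ℕ} (hμ : μ ≤ μ') :
    ∀ {E' E : Scheme.{u}} {ρ : E' ⟶ E} {𝔟 : E.IdealSheafData} {𝔟' : E'.IdealSheafData},
      IsWeightedSeq μ ρ 𝔟 𝔟' → IsWeightedSeq μ' ρ 𝔟 𝔟'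
  | _, _, _, _, _, .nil 𝔟 => .nil 𝔟
  | _, _, _, _, _, .cons τ ρ 𝔟 𝔟' 𝔟'' C ν h hC h1 hν hle hτ heq =>
    .cons τ ρ 𝔟 𝔟' 𝔟'' C ν (h.mono hμ) hC h1 (hν.trans hμ) hle hτ heq

/-! ## §2 Order-permissibility -/

/-- [OURS · L1 W5.2] **TARGET — order-permissibility** (fact-free, M): on a regular Noetherian scheme `E`, a centre
`C` with `V(C)` regular lying inside the order locus `{x | ν ≤ ord_x 𝔟}` (`idealOrder`, BGMW §3.1) satisfies
`𝔟 ≤ C ^ ν`. Proof route: at `x ∈ V(C)` the stalk `P = C_x` is a prime generated by part of a regular system of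
parameters of the regular local ring `𝒪_{E,x}`, so `P^ν` is `P`-primary (`gr_P 𝒪_{E,x}` is a polynomial ring over the
domain `𝒪_{E,x}/P`), and `𝔟_x ⊆ P^ν 𝒪_{E,η} ∩ 𝒪_{E,x} = P^{(ν)} = P^ν` where `η` is the generic point of the
component of `V(C)` through `x` (`η ∈ V(C)`, so `ν ≤ ord_η 𝔟`, and `𝔪_η = P_η`); off `V(C)` there is nothing to
show. The converse (`𝔟 ≤ C^ν ⇒ ν ≤ ord_x 𝔟` on `V(C)`) is immediate from `C_x ⊆ 𝔪_x` and is left to provers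
as a support lemma. (Parameterless Prop: sources in prose only — BGMW 2011 §3.1 p. 6 and Def. 3.1.3 (1);
Matsumura 1986 Thm. 14.4, Thm. 16.2; see the module references.) -/
def OrderPermissible : Prop :=
  ∀ (E : Scheme.{u}) [IsNoetherian E], Scheme.IsRegular E →
    ∀ (C 𝔟 : E.IdealSheafData) (ν : ℕ), Scheme.IsRegular C.subscheme →
      (∀ x : E, x ∈ C.support → (ν : ℕ∞) ≤ idealOrder 𝔟 x) → 𝔟 ≤ C ^ ν

/-! ## §3 The snc cleanup (the monomial case, translated) -/

/-- [OURS · L1 W5.2] **TARGET — weight-`μ` cleanup of an snc-supported divisor** (fact-free, M/L; any dimension): on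
an integral Noetherian regular scheme `E`, a non-zero locally principal ideal sheaf `𝔟` whose support lies in a
strict normal crossings divisor `B` is brought BELOW ORDER `μ` everywhere by a PURE weight-`μ` sequence (guard
`1 ≤ μ` inside, so that `∀ μ, WeightedCleanupSNC μ` is the by-name target).
Proof route: `𝔟 = ∏_k 𝓘(D_k)^{a_k}` over the components of `B` (S-A2 `DepthOneTargets.DivisorialFactorization`,
p495358, via `IsStrictNormalCrossingsDivisor.exists_hasSNC`); then the tree's monomial case
`exists_isResolutionOf_monomialMarked` (Resolution/MonomialOrderReduction.lean: Kollár (3.111) Step 3 — blow up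
strata `D_{j_1} ∩ ⋯ ∩ D_{j_r}` of weight `a_{j_1} + ⋯ + a_{j_r} ≥ μ`; terminates by `(m_r, n_r)`), whose centres are
regular strata inside the order-`μ` locus (`OrderPermissible`, or directly `∏ 𝓘(D_j)^{a_j} ≤ (⨆_j 𝓘(D_j))^{Σ a_j}`)
and whose transform IS the weight-`μ` controlled transform (`MarkedIdeal.transform`), ending with empty support
`= {x | μ ≤ ord_x 𝔟'} = ∅`. For `μ = 2`: peel components of multiplicity `≥ 2`, then separate intersecting
multiplicity-one components along their (regular) intersections.
[cite: Kollar2007, (3.111) Step 3] [cite: BierstoneGrigorievMilmanWlodarczyk2011, §4 Step 2b, Def. 3.1.3] -/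
def WeightedCleanupSNC (μ : ℕ) : Prop :=
  1 ≤ μ → ∀ (E : Scheme.{u}) [IsIntegral E] [IsNoetherian E], Scheme.IsRegular E →
    ∀ (B : Set E), IsStrictNormalCrossingsDivisor E B →
    ∀ 𝔟 : E.IdealSheafData, 𝔟 ≠ ⊥ → IsLocallyPrincipal 𝔟 → (𝔟.support : Set E) ⊆ B →
      ∃ (E' : Scheme.{u}) (ρ : E' ⟶ E) (𝔟' : E'.IdealSheafData),
        IsPureWeightedSeq μ ρ 𝔟 𝔟' ∧ ∀ x : E', idealOrder 𝔟' x < (μ : ℕ∞)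

/-! ## §4 The weight-two trace theorem on regular excellent threefolds -/

/-- [OURS · L1 W5.2] **TARGET W₂ — weight-two order reduction of a divisor on a regular excellent threefold**
(L; consumes CJS 2020 Thm. 1.4 WITH BOUNDARY, F-32bR, as a hypothesis inside the statement, like A2s
`DepthOneTargets.RegularizeSupport`): every non-zero locally principal ideal sheaf `𝔟` on an integral Noetherian
regular excellent scheme of dimension three is brought to ORDER `≤ 1` EVERYWHERE by a weighted sequence with
weights `≤ 2`. Proof route: (A) as in A2s (res-type-049 p496841 `DepthOneRegularize.regularizeSupport_of_seqPred`):
run the B-permissible CJS sequence of `X = (Supp 𝔟)_red ⊂ E` with `B = ∅`; a centre `Z_j` is either a singular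
point-set of the strict transform `X_j` — then `2 ≤ ord_{Z_j} 𝔟_j`, weight `2` — or consists of regular points of
`X_j` on the boundary — weight `ν_j = min (2, ord_{Z_j} 𝔟_j) ≥ 1` (`Z_j ⊆ X_j ⊆ Supp 𝔟_j`); `𝔟_j ≤ 𝓘_{Z_j}^{ν_j}` by
`OrderPermissible` (the generic points of `Z_j` lie in `Z_j`); the weight-`ν_j` controlled transform of a locally
principal ideal along a regular centre is locally principal with support `⊆` strict transform `∪` boundary; (B) at
the end `X' ∪ B'` is a strict normal crossings divisor containing `Supp 𝔟'` (CJS Cor. 1.5), and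
`WeightedCleanupSNC 2` finishes (pure weight `2 ≤ 2`). The two phases concatenate (`IsWeightedSeq` append,
`IsPureWeightedSeq.isWeightedSeq`). NOT a corollary of non-embedded resolution; NOT a statement of the manuscript.
(Parameterless Prop: sources in prose only — Cossart–Jannsen–Saito 2020 Thm. 1.4, Cor. 1.5, Def. 3.1; Kollár 2007
(3.111) Step 3; see the module references.) -/
def WeightTwoPrincipal₃ : Prop :=
  CossartJannsenSaito2020EmbeddedSequenceB.{u} →
  ∀ (E : Scheme.{u}) [IsIntegral E] [IsNoetherian E], Scheme.IsRegular E → Scheme.IsExcellent E →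
    topologicalKrullDim E = 3 → ∀ 𝔟 : E.IdealSheafData, 𝔟 ≠ ⊥ → IsLocallyPrincipal 𝔟 →
      ∃ (E' : Scheme.{u}) (ρ : E' ⟶ E) (𝔟' : E'.IdealSheafData),
        IsWeightedSeq 2 ρ 𝔟 𝔟' ∧ IsIntegral E' ∧ IsNoetherian E' ∧ Scheme.IsRegular E' ∧
        ∀ x : E', idealOrder 𝔟' x ≤ 1

end Summit.ResolutionOfSingularities.ResolutionOfSingularities.Theorems.DepthTargets

end
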